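import Summits.CriticalPhenomena.Ising3DConformalLimit.Theorems.ReflectionTwinExistsContinuousLimitReduction
import Summits.CriticalPhenomena.Ising3DConformalLimit.Theorems.ReflectionTwinExistsContinuousLimitSubsequentialInversionTransfer
import HarnessLib

/-!
# Crux `ReflectionTwin.ExistsContinuousLimit` (stmt-CriticalPhenomena-4582) — line `Sketch`
# (= crux idea `inversion-before-existence`, ideator r1 k1), lead-reshaped skeleton

Lead `prover-line-stmt-CriticalPhenomena-4582-c3-0`, 2026-08-17. The served line `Sketch`
(`Cruxes/ExistsContinuousLimit/SketchIdeator1R1.lean`) is a TYPINGS file (no `stub_*`, no theorem concluding the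
crux); this file is its reshaping into a registered skeleton. The crux (both route copies are one term):

`∃ ρ Δ S, ρ > 0 on (0,1] ∧ 0 < Δ ∧ HasPointwiseScalingLimit (criticalCorr 3) ρ S ∧ S = 0 off NonCoincident ∧
 (∀ n, ContinuousOn (S n) (NonCoincident 3 n)) ∧ IsNondegenerateTwoPoint S ∧ IsTranslationInvariant S ∧
 IsScaleCovariant Δ S`

— the OPEN existence problem of the critical `ℤ³` Ising spin scaling limit (Duminil-Copin, ICM 2022, §8.4).

## Composition (how the stubs reach the crux BY NAME)

LANDED split (p149785 / p139907): crux ⟸ item 6150 `MirrorHoelderCompactness.TwoPointDoubling` ∧ item 4659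
`ClusterRigidity.ClusterSetTotallyDisconnected`. Item 6150 enters `ExistsContinuousLimit_of` BY NAME (a route
item, not a stub of this line — it has its own lead chain). Item 4659 is produced here from

* `stub_clusterPointInversionCovariant` (K1′, the OPEN core): every normalised cluster point of the pinned `ℤ³` zoom
  is covariant under the unit inversion with SOME continuous positive weight. RESHAPE (lead c3, wave 1): the
  ideator's K1 `stub_clusterProxyUniversality` ("cluster proxy universality": the cluster point is the locally
  renormalised limit of EXACTLY inversion-symmetric lattice families `P k` with convergent pinned weight ratios) is
  EQUIVALENT to K1′ — (⟹) is the landed K3 `stub_subsequentialInversionTransfer` (p154862), (⟸) takes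
  `P k :=` the symmetrisation of `S` itself (worker audit: the abstract proxy dressing carries no lattice content), so
  the honest open stub is K1′ = the inversion half of item 4657 `ClusterPointsMoebius` with an unknown weight;
* `stub_inversionBegetsDilation` (K2, LANDED p155681; part 1 `dilation_const_of_pos` p155261 — the lead's stub):
  translation invariance + ONE weighted unit inversion ⟹ scale covariance AND inversion covariance with one exponent
  `Δ` (the weight is forced to be `‖x‖^{2Δ}`); with the LANDED rotation half `stub_inversionBegetsRotations` (item
  4675) every cluster point is then Möbius covariant (`clusterPoint_moebius`; non-degeneracy of cluster points is
  free under item 6150: `isNondegenerateTwoPoint_of_isClusterPoint`);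
* `stub_isolatedConformalClusterPoints` (TD_Möb, OPEN, CFT-side): the NON-DEGENERATE MÖBIUS-COVARIANT members of the
  cluster set of item 4659 form a totally disconnected set. Under K1–K3 (+ 6150) that subset IS the whole cluster set
  (`clusterSet_eq_conformal`), so TD_Möb ⟹ item 4659 (`clusterSetTotallyDisconnected_of`).

`ExistsContinuousLimit_of : TwoPointDoubling → K1′ → TD_Möb → ReflectionTwin.ExistsContinuousLimit` (K2 landed, used inside the landed reduction p156070).
Landed (lead c3, cycle 1): K3 p154862 (the (⟹) half of K1 ⟺ K1′, p156747 `clusterProxyUniversality_iff_inversionCovariant`);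
K2 p155261 + p155681; unconditional non-degeneracy of cluster points p156060; reduction p156070; K1′ ⟺ `∃ Δ,
IsInversionCovariant Δ S` p156705; item 4657 minus its sign clause ⟸ K1′ alone p156418; TD NECESSARY (crux ⟹ 4659 ⟹ TD)
p156975; items 4584 (p156148) and 4586 (p156913) of route `LogPolarProxy` closed on the way. OPEN (the remaining `sorry`s):
K1′ (⊂ item 4657; the only stub NOT implied by the crux) and TD_Möb (⊂ item 4659); plus item 6150 BY NAME.

Disproof used (`Cruxes/ExistsContinuousLimit/Disproof.lean`, cdisprove cycle 1 final, v1.1): §A `crux_iff_core` —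
respected, the line attacks the uniqueness half of `Core` through 4659 and keeps 6150 by name; §B load-bearing table —
K1′ quantifies over genuine cluster points of `criticalCorr 3` (clause (3) subsequentially), K2 consumes non-degeneracy
(clause (6)); §C continuity tightness — every statement below lives on `NonCoincident` / off the origin, `ContinuousOn`
only; §E — this is a different cut from line `birth` (whose single stub is stmt-1981 verbatim); no `-- Targets`, no
`_false_without_` theorem exists for this crux.
-/

noncomputable section

namespace Summit.CriticalPhenomena.Ising3DConformalLimit.ReflectionTwinExistsContinuousLimit

/-! ### Registered stubs -/

/-! Registered stub `stub_inversionBegetsDilation` (K2) is CLOSED: landed verbatim as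
`ReflectionTwinExistsContinuousLimit.stub_inversionBegetsDilation` (p155681, `Theorems/…InversionBegetsDilation.lean`,
part 1 `dilation_const_of_pos` p155261 `Theorems/…WeightedWord.lean`), imported above; K3 `stub_subsequentialInversionTransfer`
landed as p154862 (`Theorems/…SubsequentialInversionTransfer.lean`). -/

/-- Registered stub `stub_clusterPointInversionCovariant` — **K1′ (the OPEN core): every normalised cluster point
of the pinned `ℤ³` zoom is covariant under the unit inversion `x ↦ x/‖x‖²` with SOME continuous positive weight**
(the inversion half of item 4657 `ClusterPointsMoebius`, weight unknown; equivalent to the ideator's "cluster proxy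
universality" K1, whose (⟹) half is the landed K3 p154862). [cite: DuminilCopinICM2022, §8.4 p. 29] -/
theorem stub_clusterPointInversionCovariant :
    ∀ S : Literature.Probability.LatticeModels.CorrFamily 3,
      (∀ n z, z ∉ Literature.Probability.LatticeModels.NonCoincident 3 n → S n z = 0) →
      Summit.CriticalPhenomena.Ising3DConformalLimit.MoebiusLimitExistsOnlyInteraction.IsClusterPoint S →
      ∃ w : EuclideanSpace ℝ (Fin 3) → ℝ, (∀ v, v ≠ 0 → 0 < w v) ∧ ContinuousOn w {0}ᶜ ∧
        ∀ (n : ℕ) (x : Fin n → EuclideanSpace ℝ (Fin 3)), (∀ i, x i ≠ 0) →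
          S n (fun i => EuclideanGeometry.inversion (0 : EuclideanSpace ℝ (Fin 3)) 1 (x i)) =
            (∏ i, w (x i)) * S n x := by
  sorry

/-- Registered stub `stub_isolatedConformalClusterPoints` — **TD_Möb (OPEN, CFT-side isolation): the non-degenerate
Möbius-covariant members of the cluster set of the self-normalised critical `ℤ³` correlators (the set of item 4659
`ClusterRigidity.ClusterSetTotallyDisconnected`, verbatim) form a totally disconnected subset of `CorrFamily 3`
(product topology).** Item 4659 with its lattice-side half (covariance of cluster points) discharged by K1–K3.
[cite: Rychkov2020, p. 8] -/
theorem stub_isolatedConformalClusterPoints :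
    IsTotallyDisconnected {S : Literature.Probability.LatticeModels.CorrFamily 3 |
      ((∀ n x, x ∉ Literature.Probability.LatticeModels.NonCoincident 3 n → S n x = 0) ∧
        ∃ u : ℕ → ℝ, (∀ k, u k ∈ Set.Ioc (0:ℝ) 1) ∧ Filter.Tendsto u Filter.atTop (nhds 0) ∧
          ∀ n, TendstoLocallyUniformlyOn
            (fun k => Literature.Probability.LatticeModels.rescaledCorrelator
              (Literature.Probability.LatticeModels.criticalCorr 3)
              (fun δ : ℝ => (Literature.Probability.LatticeModels.criticalTwoPoint 3 (Pi.single 0 ⌊δ⁻¹⌋)) ^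
                (-(1/2:ℝ))) n (u k))
            (S n) Filter.atTop (Literature.Probability.LatticeModels.NonCoincident 3 n)) ∧
      Literature.Probability.LatticeModels.IsNondegenerateTwoPoint S ∧
      ∃ Δ : ℝ, Literature.Probability.LatticeModels.IsMoebiusCovariant Δ S} := by
  sorry

/-! ### The stub statements BY NAME (hypotheses of `ExistsContinuousLimit_of`; `abbrev`s repeating the registered
signatures verbatim — the device of `Lines/birth.lean`) -/
namespace __Registered

/-- Alias of the statement of `stub_clusterPointInversionCovariant` (K1′). -/
abbrev stub_clusterPointInversionCovariant : Prop :=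
    ∀ S : Literature.Probability.LatticeModels.CorrFamily 3,
      (∀ n z, z ∉ Literature.Probability.LatticeModels.NonCoincident 3 n → S n z = 0) →
      Summit.CriticalPhenomena.Ising3DConformalLimit.MoebiusLimitExistsOnlyInteraction.IsClusterPoint S →
      ∃ w : EuclideanSpace ℝ (Fin 3) → ℝ, (∀ v, v ≠ 0 → 0 < w v) ∧ ContinuousOn w {0}ᶜ ∧
        ∀ (n : ℕ) (x : Fin n → EuclideanSpace ℝ (Fin 3)), (∀ i, x i ≠ 0) →
          S n (fun i => EuclideanGeometry.inversion (0 : EuclideanSpace ℝ (Fin 3)) 1 (x i)) =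
            (∏ i, w (x i)) * S n x

/-- Alias of the statement of `stub_isolatedConformalClusterPoints` (TD_Möb). -/
abbrev stub_isolatedConformalClusterPoints : Prop :=
    IsTotallyDisconnected {S : Literature.Probability.LatticeModels.CorrFamily 3 |
      ((∀ n x, x ∉ Literature.Probability.LatticeModels.NonCoincident 3 n → S n x = 0) ∧
        ∃ u : ℕ → ℝ, (∀ k, u k ∈ Set.Ioc (0:ℝ) 1) ∧ Filter.Tendsto u Filter.atTop (nhds 0) ∧
          ∀ n, TendstoLocallyUniformlyOn
            (fun k => Literature.Probability.LatticeModels.rescaledCorrelator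
              (Literature.Probability.LatticeModels.criticalCorr 3)
              (fun δ : ℝ => (Literature.Probability.LatticeModels.criticalTwoPoint 3 (Pi.single 0 ⌊δ⁻¹⌋)) ^
                (-(1/2:ℝ))) n (u k))
            (S n) Filter.atTop (Literature.Probability.LatticeModels.NonCoincident 3 n)) ∧
      Literature.Probability.LatticeModels.IsNondegenerateTwoPoint S ∧
      ∃ Δ : ℝ, Literature.Probability.LatticeModels.IsMoebiusCovariant Δ S}

end __Registered

/-! ### Glue: LANDED as `Theorems/ReflectionTwinExistsContinuousLimitReduction.lean` (p156070; imported above) —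
`isNondegenerateTwoPoint_of_isClusterPoint` (6150 ⟹ cluster points non-degenerate), `isTranslationInvariant_of_isClusterPoint`,
`clusterPoint_moebius_of_inversionCovariant` (6150 ∧ K1′ ⟹ Möbius, via the landed K2 p155681 and item 4675),
`clusterPointsMoebius_of_doubling_of_inversionCovariant` (item 4657 minus its sign clause), `clusterSet_eq_conformal`,
`existsContinuousLimit_of_doubling_of_inversionCovariant_of_isolated` (6150 ∧ K1′ ∧ TD ⟹ crux). -/

/-- **Composition `ExistsContinuousLimit_of : item 6150 → K1′ → TD_Möb → ReflectionTwin.ExistsContinuousLimit`**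
(kernel-checked, no `sorry`; K2 is landed and consumed inside the landed reduction
`existsContinuousLimit_of_doubling_of_inversionCovariant_of_isolated`, p156070): the two open stubs give item 4659, and the
LANDED split (p149785) closes the crux BY NAME from item 6150 and item 4659. [folklore] -/
theorem ExistsContinuousLimit_of :
    Summit.CriticalPhenomena.Ising3DConformalLimit.Theses.MirrorHoelderCompactness.TwoPointDoubling →
    __Registered.stub_clusterPointInversionCovariant →
    __Registered.stub_isolatedConformalClusterPoints →
    Summit.CriticalPhenomena.Ising3DConformalLimit.Theses.ReflectionTwin.ExistsContinuousLimit :=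
  fun hD hK1 hTD => existsContinuousLimit_of_doubling_of_inversionCovariant_of_isolated hD hK1 hTD

/-- **The registered stubs discharge the stub hypotheses of `ExistsContinuousLimit_of` verbatim** (kernel-checked
`example`; item 6150 stays a hypothesis BY NAME — it is an item with its own lead chain, not a stub of this line). -/
example (hD : Summit.CriticalPhenomena.Ising3DConformalLimit.Theses.MirrorHoelderCompactness.TwoPointDoubling) :
    Summit.CriticalPhenomena.Ising3DConformalLimit.Theses.ReflectionTwin.ExistsContinuousLimit :=
  ExistsContinuousLimit_of hD stub_clusterPointInversionCovariant stub_isolatedConformalClusterPoints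

end Summit.CriticalPhenomena.Ising3DConformalLimit.ReflectionTwinExistsContinuousLimit

end
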